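import Summits.NavierStokesRegularity.NavierStokesRegularity.Theses.OddMorawetz
import Summits.NavierStokesRegularity.NavierStokesRegularity.Theorems.OddMorawetzMorawetzKillsTypeIReflectDivFree
import Summits.NavierStokesRegularity.NavierStokesRegularity.Theorems.OddMorawetzMorawetzKillsTypeIReflectEulerBilinear
import Summits.NavierStokesRegularity.NavierStokesRegularity.Theorems.OddMorawetzMorawetzKillsTypeIReflectJet
import Summits.NavierStokesRegularity.NavierStokesRegularity.Theorems.OddMorawetzMorawetzKillsTypeIWeightParity
import Summits.NavierStokesRegularity.NavierStokesRegularity.Theorems.OddMorawetzMorawetzKillsTypeIReflectSchwartz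
import HarnessLib

/-!
# Route OddMorawetz — `MorawetzKillsTypeI`: even derivative weights carry no Morawetz certificate

(crux item `stmt-NavierStokesRegularity-1377`, line `birth`; lands `--supports` the crux.)

A MORAWETZ CERTIFICATE of the route is an admissible local density `(k, m)` on 3-jets
`z = (z₀, z₁, z₂, z₃)` of vector fields on `ℝ³` — `m` smooth, pointwise a cubic form
(`m(μ z) = μ³ m(z)` for all real `μ`), of derivative weight `k` under positive dilations
(`m(z₀, s z₁, s² z₂, s³ z₃) = s^k m(z)`, `s > 0`) — whose exact Euler derivative
`Q_m(v) = −∫ Dm(Jv)[J B(v,v)]` (`B = eulerBilinear`, the Leray-projected nonlinearity, pressure included;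
`Jv(x) = (v x, Dv x, D²v x, D³v x)`) is `≥ 0` on all divergence-free Schwartz fields and `> 0` on one.

Main results.
* `morawetzQ_reflect` — the REFLECTION LAW: for the spatial reflection `P v (x) := −v(−x)` and every field
  `v`, `Q_m(P v) = (−1)^{k+1} Q_m(v)`. Ingredients (all landed as stubs of this line): `B(Pv,Pv) = P B(v,v)`
  (`stub_reflect_eulerBilinear`, the Leray symbol is even), `Dⁿ(Pv)(x) = (−1)^{n+1} Dⁿv(−x)`
  (`stub_reflect_jet`), the weight parity `m(z₀, −z₁, z₂, −z₃) = (−1)^k m(z)` (`stub_weightParity`: a smooth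
  pointwise cubic `m` is a cubic form, so the weight identity is polynomial in `s` and extends to `s = −1`),
  cubic homogeneity at `μ = −1`, the chain rule along the linear jet twist `σ(z) = (−z₀, z₁, −z₂, z₃)`
  (`fderiv_morawetzDensity_twist`), and the change of variables `x ↦ −x`.
* `no_morawetzCertificate_of_even` — for EVEN `k` the certificate hypotheses are contradictory (the sign of
  `Q_m` flips under `P`, which preserves the divergence-free Schwartz class: `stub_reflect_schwartz`,
  `stub_reflect_divFree`); no bound on `k` is needed.
* `odd_of_morawetzCertificate` — contrapositive packaging: a certificate has odd weight.

This is the "parity–scaling lemma" the route's planners use informally ("k even is dead by parity"); it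
settles the even-weight half of both cruxes of the route (the hunt `OddMorawetzLocal` can only succeed at odd
`k`, and the bridge `MorawetzKillsTypeI` is vacuous at even `k`).
-/

noncomputable section

-- the route's Theorems namespace repeats the summit name by design (Summit.<S>.<P>.Theorems, S = P)
set_option linter.dupNamespace false

namespace Summit.NavierStokesRegularity.NavierStokesRegularity.Theorems

open MeasureTheory


/-- **The sign twist of the derivative of an admissible density.** For a smooth, pointwise cubic density
`m` on 3-jets of derivative weight `k` (for `s > 0`), cubic homogeneity at `μ = −1` and the weight parity
(`stub_weightParity`) give `m(−z₀, z₁, −z₂, z₃) = (−1)^{k+1} m(z)`; by the chain rule along the linear jet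
twist `σ(z₀,z₁,z₂,z₃) = (−z₀, z₁, −z₂, z₃)`, `Dm(σ z)[σ z'] = (−1)^{k+1} Dm(z)[z']`. -/
theorem fderiv_morawetzDensity_twist {k : ℕ}
    {m : EuclideanSpace ℝ (Fin 3) × (EuclideanSpace ℝ (Fin 3) [×1]→L[ℝ] EuclideanSpace ℝ (Fin 3)) × (EuclideanSpace ℝ (Fin 3) [×2]→L[ℝ] EuclideanSpace ℝ (Fin 3)) × (EuclideanSpace ℝ (Fin 3) [×3]→L[ℝ] EuclideanSpace ℝ (Fin 3)) → ℝ}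
    (hsm : ContDiff ℝ (⊤ : ℕ∞) m) (hhom : ∀ (μ : ℝ) z, m (μ • z) = μ ^ 3 * m z)
    (hwt : ∀ (s : ℝ), 0 < s → ∀ (z₀ : EuclideanSpace ℝ (Fin 3))
          (z₁ : EuclideanSpace ℝ (Fin 3) [×1]→L[ℝ] EuclideanSpace ℝ (Fin 3))
          (z₂ : EuclideanSpace ℝ (Fin 3) [×2]→L[ℝ] EuclideanSpace ℝ (Fin 3))
          (z₃ : EuclideanSpace ℝ (Fin 3) [×3]→L[ℝ] EuclideanSpace ℝ (Fin 3)),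
          m (z₀, s • z₁, (s ^ 2) • z₂, (s ^ 3) • z₃) = s ^ k * m (z₀, z₁, z₂, z₃))
    (z₀ y₀ : EuclideanSpace ℝ (Fin 3))
    (z₁ y₁ : EuclideanSpace ℝ (Fin 3) [×1]→L[ℝ] EuclideanSpace ℝ (Fin 3))
    (z₂ y₂ : EuclideanSpace ℝ (Fin 3) [×2]→L[ℝ] EuclideanSpace ℝ (Fin 3))
    (z₃ y₃ : EuclideanSpace ℝ (Fin 3) [×3]→L[ℝ] EuclideanSpace ℝ (Fin 3)) :
    fderiv ℝ m (-z₀, z₁, -z₂, z₃) (-y₀, y₁, -y₂, y₃) =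
      (-1 : ℝ) ^ (k + 1) * fderiv ℝ m (z₀, z₁, z₂, z₃) (y₀, y₁, y₂, y₃) := by
  -- the linear jet twist `σ`
  let σ : (EuclideanSpace ℝ (Fin 3) × (EuclideanSpace ℝ (Fin 3) [×1]→L[ℝ] EuclideanSpace ℝ (Fin 3)) ×
      (EuclideanSpace ℝ (Fin 3) [×2]→L[ℝ] EuclideanSpace ℝ (Fin 3)) ×
      (EuclideanSpace ℝ (Fin 3) [×3]→L[ℝ] EuclideanSpace ℝ (Fin 3))) →L[ℝ]
      (EuclideanSpace ℝ (Fin 3) × (EuclideanSpace ℝ (Fin 3) [×1]→L[ℝ] EuclideanSpace ℝ (Fin 3)) ×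
      (EuclideanSpace ℝ (Fin 3) [×2]→L[ℝ] EuclideanSpace ℝ (Fin 3)) ×
      (EuclideanSpace ℝ (Fin 3) [×3]→L[ℝ] EuclideanSpace ℝ (Fin 3))) :=
    (-ContinuousLinearMap.id ℝ (EuclideanSpace ℝ (Fin 3))).prodMap
      ((ContinuousLinearMap.id ℝ (EuclideanSpace ℝ (Fin 3) [×1]→L[ℝ] EuclideanSpace ℝ (Fin 3))).prodMap
        ((-ContinuousLinearMap.id ℝ (EuclideanSpace ℝ (Fin 3) [×2]→L[ℝ] EuclideanSpace ℝ (Fin 3))).prodMap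
          (ContinuousLinearMap.id ℝ (EuclideanSpace ℝ (Fin 3) [×3]→L[ℝ] EuclideanSpace ℝ (Fin 3)))))
  have hσ : ∀ (a₀ : EuclideanSpace ℝ (Fin 3))
      (a₁ : EuclideanSpace ℝ (Fin 3) [×1]→L[ℝ] EuclideanSpace ℝ (Fin 3))
      (a₂ : EuclideanSpace ℝ (Fin 3) [×2]→L[ℝ] EuclideanSpace ℝ (Fin 3))
      (a₃ : EuclideanSpace ℝ (Fin 3) [×3]→L[ℝ] EuclideanSpace ℝ (Fin 3)),
      σ (a₀, a₁, a₂, a₃) = (-a₀, a₁, -a₂, a₃) := by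
    intro a₀ a₁ a₂ a₃
    simp [σ]
  -- `m ∘ σ = (−1)^{k+1} m`
  have hcomp : (m ∘ σ) = fun z => (-1 : ℝ) ^ (k + 1) * m z := by
    funext z
    obtain ⟨a₀, a₁, a₂, a₃⟩ := z
    have h1 : ((-1 : ℝ) • ((a₀, -a₁, a₂, -a₃) : EuclideanSpace ℝ (Fin 3) ×
        (EuclideanSpace ℝ (Fin 3) [×1]→L[ℝ] EuclideanSpace ℝ (Fin 3)) ×
        (EuclideanSpace ℝ (Fin 3) [×2]→L[ℝ] EuclideanSpace ℝ (Fin 3)) ×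
        (EuclideanSpace ℝ (Fin 3) [×3]→L[ℝ] EuclideanSpace ℝ (Fin 3)))) = (-a₀, a₁, -a₂, a₃) := by
      rw [Prod.smul_mk, Prod.smul_mk, Prod.smul_mk, Prod.mk.injEq, Prod.mk.injEq, Prod.mk.injEq]
      refine ⟨?_, ?_, ?_, ?_⟩
      · simp
      · ext; simp
      · ext; simp
      · ext; simp
    have h2 := hhom (-1) (a₀, -a₁, a₂, -a₃)
    rw [h1] at h2
    have h3 := stub_weightParity k m hsm hhom hwt a₀ a₁ a₂ a₃
    simp only [Function.comp_apply, hσ]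
    rw [h2, h3]
    ring
  have hdm : DifferentiableAt ℝ m (σ (z₀, z₁, z₂, z₃)) :=
    (hsm.differentiable (by simp)).differentiableAt
  have hchain : fderiv ℝ (m ∘ σ) (z₀, z₁, z₂, z₃) = (fderiv ℝ m (σ (z₀, z₁, z₂, z₃))).comp σ := by
    rw [fderiv_comp _ hdm σ.differentiableAt, ContinuousLinearMap.fderiv]
  have hlhs : fderiv ℝ m (-z₀, z₁, -z₂, z₃) (-y₀, y₁, -y₂, y₃) =
      fderiv ℝ (m ∘ σ) (z₀, z₁, z₂, z₃) (y₀, y₁, y₂, y₃) := by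
    rw [hchain, ContinuousLinearMap.comp_apply, hσ, hσ]
  have hrhs : fderiv ℝ (fun z => (-1 : ℝ) ^ (k + 1) * m z) (z₀, z₁, z₂, z₃) =
      (-1 : ℝ) ^ (k + 1) • fderiv ℝ m (z₀, z₁, z₂, z₃) :=
    fderiv_const_mul ((hsm.differentiable (by simp)).differentiableAt) _
  rw [hlhs, hcomp, hrhs]
  rfl

/-- **The reflection law of the Euler derivative of an admissible density.** For the spatial reflection
`P v (x) = −v(−x)`, a smooth pointwise-cubic density `m` of derivative weight `k` (for `s > 0`), and EVERY
field `v` on `ℝ³` (no regularity or integrability is needed — each step is a symmetry valid also for the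
Bochner junk values): `Q_m(P v) = (−1)^{k+1} Q_m(v)`, where `Q_m(v) = −∫ Dm(Jv)[J B(v,v)]` is the crux's
`Q` written out (`B = eulerBilinear`, `Jv(x) = (v x, Dv x, D²v x, D³v x)`). Proof: `B(Pv,Pv) = P B(v,v)`
(`stub_reflect_eulerBilinear`), the jets of reflected fields are sign-twisted reflected jets
(`stub_reflect_jet`), the density derivative absorbs the twist with the factor `(−1)^{k+1}`
(`fderiv_morawetzDensity_twist`), and Lebesgue measure is reflection invariant. -/
theorem morawetzQ_reflect {k : ℕ}
    {m : EuclideanSpace ℝ (Fin 3) × (EuclideanSpace ℝ (Fin 3) [×1]→L[ℝ] EuclideanSpace ℝ (Fin 3)) × (EuclideanSpace ℝ (Fin 3) [×2]→L[ℝ] EuclideanSpace ℝ (Fin 3)) × (EuclideanSpace ℝ (Fin 3) [×3]→L[ℝ] EuclideanSpace ℝ (Fin 3)) → ℝ}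
    (hsm : ContDiff ℝ (⊤ : ℕ∞) m) (hhom : ∀ (μ : ℝ) z, m (μ • z) = μ ^ 3 * m z)
    (hwt : ∀ (s : ℝ), 0 < s → ∀ (z₀ : EuclideanSpace ℝ (Fin 3))
          (z₁ : EuclideanSpace ℝ (Fin 3) [×1]→L[ℝ] EuclideanSpace ℝ (Fin 3))
          (z₂ : EuclideanSpace ℝ (Fin 3) [×2]→L[ℝ] EuclideanSpace ℝ (Fin 3))
          (z₃ : EuclideanSpace ℝ (Fin 3) [×3]→L[ℝ] EuclideanSpace ℝ (Fin 3)),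
          m (z₀, s • z₁, (s ^ 2) • z₂, (s ^ 3) • z₃) = s ^ k * m (z₀, z₁, z₂, z₃))
    (v : EuclideanSpace ℝ (Fin 3) → EuclideanSpace ℝ (Fin 3)) :
    (-∫ x, fderiv ℝ m
        ((fun x => -v (-x)) x, iteratedFDeriv ℝ 1 (fun x => -v (-x)) x,
          iteratedFDeriv ℝ 2 (fun x => -v (-x)) x, iteratedFDeriv ℝ 3 (fun x => -v (-x)) x)
        (Literature.Analysis.FluidPDE.eulerBilinear (fun x => -v (-x)) (fun x => -v (-x)) x,
          iteratedFDeriv ℝ 1 (Literature.Analysis.FluidPDE.eulerBilinear (fun x => -v (-x)) (fun x => -v (-x))) x,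
          iteratedFDeriv ℝ 2 (Literature.Analysis.FluidPDE.eulerBilinear (fun x => -v (-x)) (fun x => -v (-x))) x,
          iteratedFDeriv ℝ 3 (Literature.Analysis.FluidPDE.eulerBilinear (fun x => -v (-x)) (fun x => -v (-x))) x)) =
      (-1 : ℝ) ^ (k + 1) *
        -∫ x, fderiv ℝ m (v x, iteratedFDeriv ℝ 1 v x, iteratedFDeriv ℝ 2 v x, iteratedFDeriv ℝ 3 v x)
          (Literature.Analysis.FluidPDE.eulerBilinear v v x,
            iteratedFDeriv ℝ 1 (Literature.Analysis.FluidPDE.eulerBilinear v v) x,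
            iteratedFDeriv ℝ 2 (Literature.Analysis.FluidPDE.eulerBilinear v v) x,
            iteratedFDeriv ℝ 3 (Literature.Analysis.FluidPDE.eulerBilinear v v) x) := by
  set b := Literature.Analysis.FluidPDE.eulerBilinear v v with hb
  -- the integrand of the reflected field is `(−1)^{k+1}` times the reflected integrand
  set F : EuclideanSpace ℝ (Fin 3) → ℝ := fun x =>
    fderiv ℝ m (v x, iteratedFDeriv ℝ 1 v x, iteratedFDeriv ℝ 2 v x, iteratedFDeriv ℝ 3 v x)
      (b x, iteratedFDeriv ℝ 1 b x, iteratedFDeriv ℝ 2 b x, iteratedFDeriv ℝ 3 b x) with hF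
  have hBv : Literature.Analysis.FluidPDE.eulerBilinear (fun x => -v (-x)) (fun x => -v (-x)) =
      fun x => -b (-x) := stub_reflect_eulerBilinear v
  have h1 : ∀ (w : EuclideanSpace ℝ (Fin 3) → EuclideanSpace ℝ (Fin 3)) (x : EuclideanSpace ℝ (Fin 3)),
      iteratedFDeriv ℝ 1 (fun x => -w (-x)) x = iteratedFDeriv ℝ 1 w (-x) := by
    intro w x; rw [stub_reflect_jet 1 w x]; norm_num
  have h2 : ∀ (w : EuclideanSpace ℝ (Fin 3) → EuclideanSpace ℝ (Fin 3)) (x : EuclideanSpace ℝ (Fin 3)),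
      iteratedFDeriv ℝ 2 (fun x => -w (-x)) x = -iteratedFDeriv ℝ 2 w (-x) := by
    intro w x; rw [stub_reflect_jet 2 w x]; norm_num
  have h3 : ∀ (w : EuclideanSpace ℝ (Fin 3) → EuclideanSpace ℝ (Fin 3)) (x : EuclideanSpace ℝ (Fin 3)),
      iteratedFDeriv ℝ 3 (fun x => -w (-x)) x = iteratedFDeriv ℝ 3 w (-x) := by
    intro w x; rw [stub_reflect_jet 3 w x]; norm_num
  have hpt : (fun x => fderiv ℝ m
        ((fun x => -v (-x)) x, iteratedFDeriv ℝ 1 (fun x => -v (-x)) x,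
          iteratedFDeriv ℝ 2 (fun x => -v (-x)) x, iteratedFDeriv ℝ 3 (fun x => -v (-x)) x)
        (Literature.Analysis.FluidPDE.eulerBilinear (fun x => -v (-x)) (fun x => -v (-x)) x,
          iteratedFDeriv ℝ 1 (Literature.Analysis.FluidPDE.eulerBilinear (fun x => -v (-x)) (fun x => -v (-x))) x,
          iteratedFDeriv ℝ 2 (Literature.Analysis.FluidPDE.eulerBilinear (fun x => -v (-x)) (fun x => -v (-x))) x,
          iteratedFDeriv ℝ 3 (Literature.Analysis.FluidPDE.eulerBilinear (fun x => -v (-x)) (fun x => -v (-x))) x)) =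
      fun x => (-1 : ℝ) ^ (k + 1) * F (-x) := by
    funext x
    rw [hBv]
    simp only [h1, h2, h3, hF]
    exact fderiv_morawetzDensity_twist hsm hhom hwt _ _ _ _ _ _ _ _
  rw [hpt, integral_const_mul, integral_neg_eq_self F volume]
  ring

/-- **Even derivative weights carry no Morawetz certificate.** For EVEN `k`, the certificate hypotheses of
the cruxes `OddMorawetzLocal` / `MorawetzKillsTypeI` — `m` smooth, pointwise cubic, of derivative weight `k`
for `s > 0`, `Q_m ≥ 0` on divergence-free Schwartz fields and `Q_m(v₀) > 0` for one of them (with the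
cruxes' own `let J` / `let Q`) — are contradictory: `Q_m(P v₀) = −Q_m(v₀) < 0` by `morawetzQ_reflect`,
although `P v₀` is again divergence-free Schwartz (`stub_reflect_schwartz`, `stub_reflect_divFree`).
No bound on `k` is needed. -/
theorem no_morawetzCertificate_of_even :
    ∀ (k : ℕ) (m : EuclideanSpace ℝ (Fin 3) × (EuclideanSpace ℝ (Fin 3) [×1]→L[ℝ] EuclideanSpace ℝ (Fin 3)) × (EuclideanSpace ℝ (Fin 3) [×2]→L[ℝ] EuclideanSpace ℝ (Fin 3)) × (EuclideanSpace ℝ (Fin 3) [×3]→L[ℝ] EuclideanSpace ℝ (Fin 3)) → ℝ),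
      let J := fun (v : EuclideanSpace ℝ (Fin 3) → EuclideanSpace ℝ (Fin 3)) (x : EuclideanSpace ℝ (Fin 3)) =>
        (v x, iteratedFDeriv ℝ 1 v x, iteratedFDeriv ℝ 2 v x, iteratedFDeriv ℝ 3 v x);
      let Q := fun (v : EuclideanSpace ℝ (Fin 3) → EuclideanSpace ℝ (Fin 3)) =>
        -∫ x, fderiv ℝ m (J v x) (J (Literature.Analysis.FluidPDE.eulerBilinear v v) x);
      Even k → ContDiff ℝ (⊤ : ℕ∞) m → (∀ (μ : ℝ) z, m (μ • z) = μ ^ 3 * m z) →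
      (∀ (s : ℝ), 0 < s → ∀ (z₀ : EuclideanSpace ℝ (Fin 3))
          (z₁ : EuclideanSpace ℝ (Fin 3) [×1]→L[ℝ] EuclideanSpace ℝ (Fin 3))
          (z₂ : EuclideanSpace ℝ (Fin 3) [×2]→L[ℝ] EuclideanSpace ℝ (Fin 3))
          (z₃ : EuclideanSpace ℝ (Fin 3) [×3]→L[ℝ] EuclideanSpace ℝ (Fin 3)),
          m (z₀, s • z₁, (s ^ 2) • z₂, (s ^ 3) • z₃) = s ^ k * m (z₀, z₁, z₂, z₃)) →
      (∀ v, Literature.Analysis.FluidPDE.IsSchwartzField v →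
          Literature.Analysis.FluidPDE.VectorCalculus.IsDivFree v → 0 ≤ Q v) →
      (∃ v, Literature.Analysis.FluidPDE.IsSchwartzField v ∧
          Literature.Analysis.FluidPDE.VectorCalculus.IsDivFree v ∧ 0 < Q v) → False := by
  intro k m
  dsimp only
  intro hk hsm hhom hwt hQ hpos
  obtain ⟨v₀, hv₀S, hv₀D, hv₀pos⟩ := hpos
  have hneg := hQ (fun x => -v₀ (-x)) (stub_reflect_schwartz v₀ hv₀S) (stub_reflect_divFree v₀ hv₀D)
  rw [morawetzQ_reflect hsm hhom hwt v₀, pow_succ, hk.neg_one_pow, one_mul] at hneg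
  linarith

/-- **A Morawetz certificate has odd derivative weight** (contrapositive of
`no_morawetzCertificate_of_even`): if `(k, m)` carries a certificate (the cruxes' hypotheses, with their own
`let J` / `let Q`), then `Odd k`. In particular the hunt `OddMorawetzLocal` lives at `k ∈ {1, 3, 5}` and the
bridge `MorawetzKillsTypeI` is vacuous at even `k`. -/
theorem odd_of_morawetzCertificate :
    ∀ (k : ℕ) (m : EuclideanSpace ℝ (Fin 3) × (EuclideanSpace ℝ (Fin 3) [×1]→L[ℝ] EuclideanSpace ℝ (Fin 3)) × (EuclideanSpace ℝ (Fin 3) [×2]→L[ℝ] EuclideanSpace ℝ (Fin 3)) × (EuclideanSpace ℝ (Fin 3) [×3]→L[ℝ] EuclideanSpace ℝ (Fin 3)) → ℝ),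
      let J := fun (v : EuclideanSpace ℝ (Fin 3) → EuclideanSpace ℝ (Fin 3)) (x : EuclideanSpace ℝ (Fin 3)) =>
        (v x, iteratedFDeriv ℝ 1 v x, iteratedFDeriv ℝ 2 v x, iteratedFDeriv ℝ 3 v x);
      let Q := fun (v : EuclideanSpace ℝ (Fin 3) → EuclideanSpace ℝ (Fin 3)) =>
        -∫ x, fderiv ℝ m (J v x) (J (Literature.Analysis.FluidPDE.eulerBilinear v v) x);
      ContDiff ℝ (⊤ : ℕ∞) m → (∀ (μ : ℝ) z, m (μ • z) = μ ^ 3 * m z) →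
      (∀ (s : ℝ), 0 < s → ∀ (z₀ : EuclideanSpace ℝ (Fin 3))
          (z₁ : EuclideanSpace ℝ (Fin 3) [×1]→L[ℝ] EuclideanSpace ℝ (Fin 3))
          (z₂ : EuclideanSpace ℝ (Fin 3) [×2]→L[ℝ] EuclideanSpace ℝ (Fin 3))
          (z₃ : EuclideanSpace ℝ (Fin 3) [×3]→L[ℝ] EuclideanSpace ℝ (Fin 3)),
          m (z₀, s • z₁, (s ^ 2) • z₂, (s ^ 3) • z₃) = s ^ k * m (z₀, z₁, z₂, z₃)) →
      (∀ v, Literature.Analysis.FluidPDE.IsSchwartzField v →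
          Literature.Analysis.FluidPDE.VectorCalculus.IsDivFree v → 0 ≤ Q v) →
      (∃ v, Literature.Analysis.FluidPDE.IsSchwartzField v ∧
          Literature.Analysis.FluidPDE.VectorCalculus.IsDivFree v ∧ 0 < Q v) → Odd k := by
  intro k m J Q hsm hhom hwt hQ hpos
  rcases Nat.even_or_odd k with hke | hko
  · exact (no_morawetzCertificate_of_even k m hke hsm hhom hwt hQ hpos).elim
  · exact hko

end Summit.NavierStokesRegularity.NavierStokesRegularity.Theorems

end
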